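import Literature.AnabelianGeometry.EtaleTheta.ThetaRigidityToyLevelThree
import Literature.AnabelianGeometry.EtaleTheta.ThetaRigidityLevels
import Literature.AnabelianGeometry.EtaleTheta.Discharge.Sec2Cor218ivTrivialBase
import Mathlib.GroupTheory.SpecificGroups.Dihedral
import HarnessLib

/-!
# [EtTh] Cor. 2.18 (iv): BOTH typed clauses hold SIMULTANEOUSLY at an inhabitant with a NONTRIVIAL
# cyclotome — the dihedral witness `Π^tp_X = ℤ × D₃` (proof-only)

S. Mochizuki, *The Étale Theta Function …* [EtTh], Publ. RIMS **45** (2009), §2, Cor. 2.18 (iv), PRIMS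
text pp. 61–63 (locators `p.N` = PDF pages; bib key `MochizukiEtTh2009`).

The two `ThetaEnvData`-level clauses of Cor. 2.18 (iv) typed in `ThetaRigidityLevels.lean`
(abc-iut-L2-t2) — `Cor218_iv_surjective` (F-0639: every automorphism of `Π^tp_X` preserving `Π^tp_Y`
lifts to the model mono-theta environment) and `Cor218_iv_fibre` (F-0638: the automorphisms over
`id_{Π^tp_Y}` are the `μ_N`-conjugates of the twists by `Hom(Π^tp_Y/Π^tp_Ÿ, μ_N)`) — have kernel-FALSE
universal closures (`ThetaRigidityLevelsSchemaClosures.lean`), and so far hold only SEPARATELY: the fibre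
clause at the level-`1` toy (`μ_1 = 1`), the surjectivity clause at the level-`3` ABELIAN toy, where the
fibre clause FAILS (`RigidData.ToyN3.not_forall_cor218_iv_fibre`: with `Π^tp_Y` abelian the coefficient
inversion extends to a model automorphism).  This PROOF-ONLY file (no `def`, no instance, no new named
fact) shows the two clauses are JOINTLY satisfiable with a nontrivial cyclotome:

* §1 (companion file `Discharge/Sec2Cor218ivTrivialBase.lean`, imported) — generic criteria over
  `T : ThetaEnvData N` with `G_K` trivial: `DY_eq_bot_of_forall_exists_conj`,
  `cor218_iv_surjective_of_stable` (lifting `(u, y) ↦ (ψ_γ u, γ y)`), `cor218_iv_fibre_of_rigid`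
  (`Hom(Π^tp_Y, μ_N) = 1` and theta cocycles onto `μ_N` ⇒ automorphisms over `id_{Π^tp_Y}` are trivial);
* §2 — the dihedral group `D₃`: `Hom(D₃, ℤ/3) = 1`, and its rotation subgroup is its `3`-torsion;
* §3 — **`exists_cor218_iv_fibre_and_surjective`**: at `Π^tp_X := ℤ × D₃` (discrete; the topology is a
  `letI` inside the proof), `G_K := 1`, `Π^tp_Y := 0 × D₃` (non-abelian), `Π^tp_Ÿ := 0 × ⟨r⟩ ≅ ℤ/3`,
  `μ_3 := ℤ/3`, theta cocycle `η₀ : r^i ↦ i`, BOTH clauses hold and `|μ| = 3`.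

HONEST FRAMING: statements about the cell's own typing over an abstract interface and about one explicit
toy; nothing here bears on [EtTh] (refereed) or on [IUTchIII] Cor. 3.12, and no side is taken; typed ≠
proved.  Written by the cell `abc-iut` (seat abc-iut-f-151, tranche 151).
-/

namespace Literature.AnabelianGeometry.EtaleTheta

/-! ## §2. The dihedral group `D₃`: homomorphisms to `ℤ/3`, and the rotations as the `3`-torsion -/

namespace RigidData

namespace ToyD3

open RigidData.ToyN3 (M3)

/-- In `ℤ/3` (written multiplicatively) a square root of `1` is `1`. [cite: MochizukiEtTh2009, Def 2.13 p.46] -/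
theorem M3.eq_one_of_mul_self (a : M3) (h : a * a = 1) : a = 1 := by
  revert a
  decide

/-- **`Hom(D₃, ℤ/3) = 1`**: reflections are involutions (so map to `1` in `ℤ/3`) and every rotation
is a product of two reflections. [cite: MochizukiEtTh2009, Cor 2.18(iv) p.63] -/
theorem hom_dihedral_eq_one (f : DihedralGroup 3 →* M3) : ∀ d : DihedralGroup 3, f d = 1 := by
  have hsr : ∀ i, f (DihedralGroup.sr i) = 1 := fun i =>
    M3.eq_one_of_mul_self _ (by rw [← map_mul, DihedralGroup.sr_mul_self, map_one])
  rintro (i | i)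
  · have : DihedralGroup.r i = DihedralGroup.sr 0 * DihedralGroup.sr i := by simp
    rw [this, map_mul, hsr, hsr, mul_one]
  · exact hsr i

/-- The cube of a rotation of `D₃` is trivial. [cite: MochizukiEtTh2009, Def 2.13 p.47] -/
theorem r_pow_three (i : ZMod 3) : (DihedralGroup.r i) ^ 3 = 1 := by
  rw [DihedralGroup.r_pow]
  have h3 : (i * (3 : ℕ) : ZMod 3) = 0 := by
    have : ((3 : ℕ) : ZMod 3) = 0 := by decide
    rw [this, mul_zero]
  rw [h3, DihedralGroup.r_zero]

/-- A reflection of `D₃` does not cube to `1`. [cite: MochizukiEtTh2009, Def 2.13 p.47] -/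
theorem sr_pow_three_ne_one (i : ZMod 3) : (DihedralGroup.sr i) ^ 3 ≠ 1 := by
  rw [pow_succ, pow_two, DihedralGroup.sr_mul_self, one_mul, DihedralGroup.one_def]
  exact fun h => by cases h

/-- `D₃` is not commutative: `r · s ≠ s · r`. [cite: MochizukiEtTh2009, Def 2.13 p.47] -/
theorem r_one_mul_sr_zero_ne : DihedralGroup.r (1 : ZMod 3) * DihedralGroup.sr 0 ≠
    DihedralGroup.sr 0 * DihedralGroup.r 1 := by
  decide

end ToyD3

end RigidData

/-! ## §3. The dihedral witness: both clauses of Cor. 2.18 (iv) with `μ_3 ≠ 1` -/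

namespace ThetaEnvData

open RigidData.ToyN3 (M3)

/-- **F-0638 ∧ F-0639 jointly, with a nontrivial cyclotome**: there is a `ThetaEnvData` at level `3`
— `Π^tp_X := ℤ × D₃` discrete, `G_K := 1`, `Π^tp_Y := 0 × D₃` (NON-abelian), `Π^tp_Ÿ := 0 × ⟨r⟩`,
`μ_3 := ℤ/3`, single theta cocycle `η₀ : (0, r^i) ↦ i` — at which `|μ| = 3`, `Π^tp_Y` is not commutative,
and BOTH `Cor218_iv_fibre` (by `cor218_iv_fibre_of_rigid`: `Hom(D₃, ℤ/3) = 1`, `η₀` onto) AND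
`Cor218_iv_surjective` (by `cor218_iv_surjective_of_stable`: `ℤ` is central so `Π^tp_X` acts on `Π^tp_Y`
by inner automorphisms; `Π^tp_Ÿ` is the `3`-torsion of `Π^tp_Y`; `γ` acts on `η₀` through
`η₀ ∘ γ ∘ η₀⁻¹ ∈ Aut(μ_3)`) hold. [cite: MochizukiEtTh2009, Cor 2.18(iv) p.61] -/
theorem exists_cor218_iv_fibre_and_surjective :
    ∃ T : ThetaEnvData.{0} 3, Fintype.card T.mu = 3 ∧ (∃ a b : T.PiY, a * b ≠ b * a) ∧
      Literature.AnabelianGeometry.EtaleTheta.ThetaEnvData.Cor218_iv_fibre T ∧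
      Literature.AnabelianGeometry.EtaleTheta.ThetaEnvData.Cor218_iv_surjective T := by
  classical
  letI : TopologicalSpace (DihedralGroup 3) := ⊥
  haveI : DiscreteTopology (DihedralGroup 3) := ⟨rfl⟩
  -- the group `Π := ℤ × D₃`, its subgroups `Π_Y := 0 × D₃ ⊇ Π_Ÿ := 0 × ⟨r⟩`
  let P : Type := Multiplicative ℤ × DihedralGroup 3
  let sgn : DihedralGroup 3 →* Multiplicative (ZMod 2) :=
    { toFun := fun d => Sum.elim (fun _ => 1) (fun _ => Multiplicative.ofAdd 1)
        (DihedralGroup.equivSum d)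
      map_one' := rfl
      map_mul' := by
        rintro (i | i) (j | j)
        · rfl
        · rfl
        · rfl
        · show (1 : Multiplicative (ZMod 2)) = Multiplicative.ofAdd 1 * Multiplicative.ofAdd 1
          decide }
  let PiY : Subgroup P := (MonoidHom.fst (Multiplicative ℤ) (DihedralGroup 3)).ker
  let PiYdd : Subgroup P := (sgn.comp (MonoidHom.snd (Multiplicative ℤ) (DihedralGroup 3))).ker ⊓ PiY
  have mem_PiY : ∀ x : P, x ∈ PiY ↔ x.1 = 1 := fun x => Iff.rfl
  have mem_PiYdd : ∀ x : P, x ∈ PiYdd ↔ (∃ i, x.2 = DihedralGroup.r i) ∧ x.1 = 1 := by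
    rintro ⟨z, d⟩
    change (sgn d = 1 ∧ z = 1) ↔ _
    rcases d with i | i
    · exact ⟨fun h => ⟨⟨i, rfl⟩, h.2⟩, fun h => ⟨rfl, h.2⟩⟩
    · constructor
      · rintro ⟨h, -⟩
        have h' : Multiplicative.ofAdd (1 : ZMod 2) = 1 := h
        have hne : Multiplicative.ofAdd (1 : ZMod 2) ≠ 1 := by decide
        exact absurd h' hne
      · rintro ⟨⟨j, hj⟩, -⟩
        cases hj
  -- `Π_Ÿ` is the `3`-torsion of `Π_Y`
  have mem_PiYdd_iff_pow : ∀ x : P, x ∈ PiYdd ↔ x ∈ PiY ∧ x ^ 3 = 1 := by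
    rintro ⟨z, d⟩
    rw [mem_PiYdd, mem_PiY]
    constructor
    · rintro ⟨⟨i, hi⟩, hz⟩
      refine ⟨hz, ?_⟩
      change d = _ at hi
      change z = 1 at hz
      subst hi hz
      exact Prod.ext (one_pow 3) (RigidData.ToyD3.r_pow_three i)
    · rintro ⟨hz, h⟩
      refine ⟨?_, hz⟩
      rcases d with i | i
      · exact ⟨i, rfl⟩
      · exact absurd (congrArg Prod.snd h : (DihedralGroup.sr i) ^ 3 = 1)
          (RigidData.ToyD3.sr_pow_three_ne_one i)
  have index_PiYdd : (PiYdd.subgroupOf PiY).index = 2 := by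
    change PiYdd.relIndex PiY = 2
    rw [Subgroup.inf_relIndex_right, Subgroup.relIndex_ker]
    have hmap : PiY.map (sgn.comp (MonoidHom.snd (Multiplicative ℤ) (DihedralGroup 3))) = ⊤ := by
      have key : ∀ a : Multiplicative (ZMod 2), a = 1 ∨ a = Multiplicative.ofAdd 1 := by decide
      refine top_le_iff.mp fun a _ => ?_
      rcases key a with rfl | rfl
      · exact ⟨((1 : Multiplicative ℤ), DihedralGroup.r 0), (mem_PiY _).mpr rfl, rfl⟩
      · exact ⟨((1 : Multiplicative ℤ), DihedralGroup.sr 0), (mem_PiY _).mpr rfl, rfl⟩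
    rw [hmap, Subgroup.card_top, Nat.card_eq_fintype_card]
    rfl
  haveI hPiYdd_normal : PiYdd.Normal := inferInstance
  -- the theta cocycle `η₀ : (0, r^i) ↦ i` (junk value `1` off `Π_Ÿ`)
  let q : P → M3 := fun x =>
    Sum.elim (fun i : ZMod 3 => (Multiplicative.ofAdd i : M3)) (fun _ => 1) (DihedralGroup.equivSum x.2)
  have q_mul : ∀ x y : P, x ∈ PiYdd → y ∈ PiYdd → q (x * y) = q x * q y := by
    rintro ⟨z, d⟩ ⟨z', d'⟩ hx hy
    obtain ⟨⟨i, hi⟩, -⟩ := (mem_PiYdd _).mp hx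
    obtain ⟨⟨j, hj⟩, -⟩ := (mem_PiYdd _).mp hy
    change d = _ at hi
    change d' = _ at hj
    subst hi hj
    rfl
  let η₀ : PiYdd → M3 := fun y => q y
  -- the data
  let T : ThetaEnvData.{0} 3 :=
    { PiX := P
      G := PUnit
      aug := 1
      aug_surjective := fun _ => ⟨1, Subsingleton.elim _ _⟩
      PiY := PiY
      PiY_normal := MonoidHom.normal_ker _
      PiY_open := isOpen_discrete _
      galYX := QuotientGroup.quotientKerEquivOfSurjective
        (MonoidHom.fst (Multiplicative ℤ) (DihedralGroup 3)) (fun z => ⟨(z, 1), rfl⟩)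
      PiYdd := PiYdd
      PiYdd_le := inf_le_right
      PiYdd_normal := hPiYdd_normal
      PiYdd_open := isOpen_discrete _
      index_PiYdd := index_PiYdd
      mu := M3
      mu_cyclic := inferInstance
      card_mu := rfl
      chi := 1
      chi_ker_open := isOpen_discrete _
      thetaCocycles := {η₀}
      thetaCocycles_nonempty := Set.singleton_nonempty _
      isCocycle := by
        rintro η hη
        rw [Set.mem_singleton_iff] at hη
        subst hη
        intro x y
        change q ((x : P) * y) = q x * q y
        exact q_mul x y x.2 y.2
      locallyConstant := fun η _ => IsLocallyConstant.of_discrete η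
      mul_coboundary_mem := by
        rintro η hη c
        rw [Set.mem_singleton_iff] at hη ⊢
        subst hη
        funext x
        simp [CycEnvelope.coboundary] }
  haveI hG : Subsingleton T.G := inferInstanceAs (Subsingleton PUnit)
  refine ⟨T, rfl, ?_, ?_, ?_⟩
  · -- `Π_Y = D₃` is not abelian
    refine ⟨⟨((1 : Multiplicative ℤ), DihedralGroup.r 1), (mem_PiY _).mpr rfl⟩,
      ⟨((1 : Multiplicative ℤ), DihedralGroup.sr 0), (mem_PiY _).mpr rfl⟩, fun h => ?_⟩
    have h' : DihedralGroup.r (1 : ZMod 3) * DihedralGroup.sr 0 = DihedralGroup.sr 0 * DihedralGroup.r 1 :=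
      congrArg (fun x : T.PiY => (x : P).2) h
    exact RigidData.ToyD3.r_one_mul_sr_zero_ne h'
  · -- the fibre clause, by rigidity
    refine T.cor218_iv_fibre_of_rigid (fun f => ?_) ?_
    · -- `Hom(Π_Y, ℤ/3) = 1`: pull back along `d ↦ (0, d)`
      let ι : DihedralGroup 3 →* T.PiY :=
        { toFun := fun d => ⟨((1 : Multiplicative ℤ), d), (mem_PiY _).mpr rfl⟩
          map_one' := rfl
          map_mul' := fun _ _ => rfl }
      refine MonoidHom.ext fun y => ?_
      have hy : y = ι (y : P).2 := by
        apply Subtype.ext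
        obtain ⟨⟨z, d⟩, hzd⟩ := y
        have hz : z = 1 := (mem_PiY _).mp hzd
        subst hz
        rfl
      rw [hy, MonoidHom.one_apply]
      exact RigidData.ToyD3.hom_dihedral_eq_one (f.comp ι) _
    · rintro η hη
      have h1 : η = η₀ := hη
      subst h1
      intro a
      exact ⟨⟨((1 : Multiplicative ℤ), DihedralGroup.r (Multiplicative.toAdd a)),
        (mem_PiYdd _).mpr ⟨⟨_, rfl⟩, rfl⟩⟩, rfl⟩
  · -- the surjectivity clause, by stability
    refine T.cor218_iv_surjective_of_stable (fun x => ?_) (fun γ hγ g hg => ?_)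
      (fun γ hγdd η hη => ?_)
    · -- `ℤ` is central: `(n, d)` acts on `Π_Y` as conjugation by `(0, d)`
      refine ⟨⟨((1 : Multiplicative ℤ), (x : P).2), (mem_PiY _).mpr rfl⟩, fun h => ?_⟩
      obtain ⟨z, d⟩ := x
      change ((z, d) : P) * (h : P) * (z, d)⁻¹ = ((1 : Multiplicative ℤ), d) * (h : P) * (1, d)⁻¹
      refine Prod.ext ?_ rfl
      change z * (h : P).1 * z⁻¹ = 1 * (h : P).1 * 1⁻¹
      rw [mul_inv_cancel_comm, one_mul, inv_one, mul_one]
    · -- automorphisms preserving `Π_Y` preserve its `3`-torsion `Π_Ÿ`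
      obtain ⟨hgY, hg3⟩ := (mem_PiYdd_iff_pow g).mp hg
      exact (mem_PiYdd_iff_pow _).mpr ⟨hγ.le ⟨g, hgY, rfl⟩, by rw [← map_pow, hg3, map_one]⟩
    · -- the coefficient automorphism `ψ_γ := η₀ ∘ γ ∘ η₀⁻¹`
      have h1 : η = η₀ := hη
      subst h1
      let e : M3 →* P :=
        { toFun := fun t => ((1 : Multiplicative ℤ), DihedralGroup.r (Multiplicative.toAdd t))
          map_one' := rfl
          map_mul' := fun _ _ => rfl }
      have he : ∀ t, e t ∈ PiYdd := fun t => (mem_PiYdd _).mpr ⟨⟨_, rfl⟩, rfl⟩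
      have hqe : ∀ t, q (e t) = t := fun t => rfl
      have heq : ∀ x : P, x ∈ PiYdd → e (q x) = x := by
        rintro ⟨z, d⟩ hx
        obtain ⟨⟨i, hi⟩, hz⟩ := (mem_PiYdd _).mp hx
        change d = _ at hi
        change z = 1 at hz
        subst hi hz
        rfl
      let ψf : M3 →* M3 :=
        { toFun := fun t => q (γ (e t))
          map_one' := by
            change q (γ (e 1)) = 1
            rw [map_one, map_one]
            rfl
          map_mul' := fun s t => by
            change q (γ (e (s * t))) = q (γ (e s)) * q (γ (e t))
            rw [map_mul, map_mul, q_mul _ _ (hγdd _ (he s)) (hγdd _ (he t))] }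
      have hψf_inj : Function.Injective ψf := by
        intro s t hst
        have h2 : γ (e s) = γ (e t) := by
          rw [← heq _ (hγdd _ (he s)), ← heq _ (hγdd _ (he t))]
          exact congrArg e hst
        have h3 : e s = e t := γ.injective h2
        rw [← hqe s, ← hqe t, h3]
      refine ⟨MulEquiv.ofBijective ψf ⟨hψf_inj, Finite.injective_iff_surjective.mp hψf_inj⟩,
        fun y => ?_⟩
      change q (γ (e (q y))) = q (γ y)
      rw [heq _ y.2]

end ThetaEnvData

end Literature.AnabelianGeometry.EtaleTheta
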